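import Literature.Analysis.Calculus.RadiiPolynomialTwoRadii
import HarnessLib

/-!
# Radii-polynomial closing certificates: exact predicates, kernel-decidable checks, soundness
# (certificate kind `cap-nk/1`, forms `contraction`, `quadratic`, `polynomial`)

Topic `Literature/Computation/Certificates`.  A Newton–Kantorovich / radii-polynomial validation of a
zero of `F : X → Y` (`X` real Banach, `Y` real normed, `A : Y →L X` an injective approximate inverse of
`DF(x̄)`) ends with a SCALAR CLOSING: a handful of exact-rational inequalities between the bounds
`Y, Z` (or `Y₀, Z₀, Z₁, Z₂`, or `Y₀` and the coefficients of `Z(r) = Σ Z_k r^k`) and two radii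
`r_min ≤ r_max`.  The engine `cap.nk` (Engine D, schema `cap-nk/1`, `radii.py` 0.1.1) writes exactly
these inequalities as the `required` lines of its `transcript`, decided in exact rational arithmetic and
re-derived by two code-disjoint verifiers; the analytic theorems they instantiate are PROVED in
`Literature/Analysis/Calculus/RadiiPolynomial.lean` and `RadiiPolynomialTwoRadii.lean`.  This file is
the typed bridge — for each form:

* a certificate record over `ℚ` (the numbers a `cap-nk/1` document carries in `inputs[*].exact` and
  `result.r_min / r_max`);
* `check : Bool`, the conjunction of the transcript lines, decidable by the kernel (`decide`) and
  unfolded by `check_eq_true_iff` to plain inequalities (so a client row closes by `decide` or by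
  `rw [check_eq_true_iff]; norm_num`);
* `check_mono`, the ENDPOINT RULE of `radii.py` ("the UPPER endpoint is used for `Y, Z…` — valid and
  tightest, since every radii polynomial is non-decreasing in the bounds"): a passing certificate still
  passes when any bound is replaced by a smaller one, radii unchanged;
* `sound`, the soundness statement: `check = true` AND the analytic hypotheses the certificate's
  `hypotheses` block lists for the client's `F, x̄, A` (differentiability on the closed ball of radius
  `r*`, and the bounds being bounds) imply a zero of `F` within `r_min` of `x̄`, unique within `r_max`
  (resp. `r*`), with every `F'(z)` on that ball invertible and `‖F'(z)⁻¹‖ ≤ ‖A‖/(1 − Z)`, and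
  convergence of the Newton-like iterates `x ↦ x − A F(x)` from `x̄`.

## Sources (read on the page; the analytic content is in the two imported files, whose docstrings quote them)

* Form `contraction`: K. Constantineau, C. García-Azpeitia, J.-P. Lessard, Qual. Theory Dyn. Syst. **20**
  (2021), arXiv:2107.05118, **Thm. 3.1** (p. 8): "`‖AF(ū)‖ ≤ Y`, `sup_{z ∈ B̄_{r*}(ū)} ‖I − A DF(z)‖ ≤ Z`,
  `p(r) = (Z − 1) r + Y`; if `p(r₀) < 0` for some `r₀ ∈ (0, r*]` then there is a unique `ũ ∈ B_{r₀}(ū)`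
  with `F(ũ) = 0`" — Lean `Literature.Analysis.Calculus.existsUnique_zero_of_newtonLike_twoRadii(_of_le)`.
  `radii.py` lines: `Z_lt_1: Z < 1`, `radii_at_rmax: (Z−1)·r* + Y < 0`, `radii_at_rmin: Y + Z·r_min ≤ r_min`
  with `r_min = Y/(1 − Z)`, `rmin_le_rstar: r_min ≤ r*`.
* Form `quadratic`: J.-P. Lessard, J. D. Mireles James, SIAM J. Math. Anal. **49** (2017) **Thm. 1.5**
  (pp. 4–5), bounds (3)–(6) `‖AF(x̄)‖ ≤ Y₀`, `‖I − AA†‖ ≤ Z₀`, `‖A[DF(x̄) − A†]‖ ≤ Z₁`,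
  `‖A[DF(b) − DF(x̄)]‖ ≤ Z₂ r ∀ b ∈ B̄_r(x̄)`, radii polynomial (7) `p(r) = Z₂ r² − (1 − Z₁ − Z₀) r + Y₀`;
  "if there exists `r₀ > 0` such that `p(r₀) < 0`, then there exists a unique `x̃ ∈ B_{r₀}(x̄)` with
  `F(x̃) = 0`" (= Calleja–García-Azpeitia–Lessard–Mireles James 2021 Thm. 8) — Lean
  `existsUnique_zero_of_radiiPolynomial_twoRadii`.  `radii.py` lines: `Z01_lt_1`, `disc_pos`,
  `p_rmin_neg: p(r_min) < 0`, `p_rmax_neg: p(r_max) < 0`, `rmin_le_rmax`, `rmax_le_rstar`.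
* Form `polynomial` (general degree, `Z(r) = Σ_k Z_k r^k ≥ sup_{B̄_r(x̄)} ‖I − A DF‖` for `0 ≤ r ≤ r*`,
  `p(r) = Y₀ + (Z(r) − 1) r`): S. Day, J.-P. Lessard, K. Mischaikow, SIAM J. Numer. Anal. **45** (2007)
  §2 [DayLessardMischaikow2007] (cited through `radii.py` THEOREMS and the tree's `RadiiPolynomial.lean`
  docstring; the printed pages are not held — acquisition want W3-2 of `lit/FRESHNESS-CERTNUM.md` §3.9);
  mathematically it is the contraction form applied at `r* = r₀` with `Z := Z(r₀)`, which is how it is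
  proved here.  `radii.py` lines: `Z0_lt_1`, `p_rmin_neg`, `p_rmax_neg`, `rmin_le_rmax`, `rmax_le_rstar`.
* Non-degeneracy riders: I. K. Argyros, *Convergence and Applications of Newton-type Iterations* (2008)
  Thm. 1.1.12 eq. (1.1.10) `‖T⁻¹‖ ≤ ‖P‖/(1 − ‖I − PT‖)` (Lean `fderiv_invertible_of_newtonLike`), and the
  Neumann bound `‖(A DF(z))⁻¹‖ ≤ 1/(1 − Z)` = `radii.py`'s `inverse_factor` (Calleja et al. 2021 Cor. 9;
  Lean `isInvertible_comp_of_norm_id_sub_lt` + `norm_symm_le_of_norm_id_sub_le`).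

## What a passing certificate does NOT certify (stated once; every `sound` theorem takes these as hypotheses)
(D) that the client's `F` is Fréchet differentiable on `B̄(x̄, r*)` with the derivative `F'` used;
(J)/(Y)/(Z) that the exact rationals `Y, Z, …` of the certificate ARE upper bounds of the stated norms for
the client's `F, x̄, A, A†` — that is the bound-producing layer (interval arithmetic with directed
rounding, the engine's and the client's obligation, replayed by a second code path); the injectivity of
`A` in infinite dimension; the identification of `F` with the object of the client's theorem; anything
behind a discretisation.  The `check` lines here are a SUBSET of `radii.py`'s required lines (a cap-nk/1
PASS implies `check = true` with the same numbers: `ContractionCert.check_of_strictLine`,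
`QuadraticCert`/`PolynomialCert` take `r_min, r_max` verbatim), chosen as exactly the hypotheses of the
Lean theorems; `disc_pos` and `Z01_lt_1` are consequences of `p(r_min) < 0` (`quadraticPoly_sum_lt_one`).
Not typed here: form `kantorovich` (classical Newton–Kantorovich, `h = Kη ≤ ½`; its theorem is the
discharged named fact `Literature.Analysis.Calculus.NewtonKantorovich` — a certificate bridge needs the
uniqueness statement relative to `B̄(x₀, R) ⊆ D`, which the tree's `NewtonKantorovichUniqueness` does not
give when `R < ρ₊`), and form `plum` (Plum's `δ ≤ α/K − ∫g`; `PlumExistenceEnclosure.lean`).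

## Search
`lean search 'ContractionCert|QuadraticCert|PolynomialCert|radiiPoly|NKCert'`: no certificate-side
declaration for radii polynomials in the tree (client rows such as
`Literature/Analysis/FluidPDE/OkamotoSakajoWunsch2008/Certificate*.lean` close the inequality
`Y + Z·r < r` ad hoc by `norm_num` against `existsUnique_zero_of_newtonLike`); patterns followed:
`Literature.Analysis.ODE.HOEStepCert` (`check : Bool`, `sound`), `Certificates/LinearProgramming.lean`.
-/

open Metric Set Filter Function
open scoped Topology

namespace Literature.Computation.Certificates

namespace RadiiPolynomialCertificate

open Literature.Analysis.Calculus

/-! ## The radii polynomials as functions over an ordered field, and the endpoint rule -/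

section Polynomials

variable {K : Type*} [Field K]

/-- The contraction-form radii polynomial `p(r) = (Z − 1) r + Y` of
[ConstantineauGarciaAzpeitiaLessard2021] Thm. 3.1 (`radii.py` form `contraction`).
[cite: ConstantineauGarciaAzpeitiaLessard2021, Thm. 3.1 (arXiv p. 8)] -/
def contractionPoly (Y Z r : K) : K := (Z - 1) * r + Y

/-- The quadratic radii polynomial `p(r) = Z₂ r² − (1 − Z₁ − Z₀) r + Y₀`, eq. (7) of
[LessardMirelesJames2017] Thm. 1.5 (`radii.py` form `quadratic`).
[cite: LessardMirelesJames2017, Thm. 1.5 eq. (7) (p. 5)] -/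
def quadraticPoly (Y₀ Z₀ Z₁ Z₂ r : K) : K := Z₂ * r ^ 2 - (1 - Z₁ - Z₀) * r + Y₀

/-- Horner evaluation `Z(r) = Z_0 + r (Z_1 + r (Z_2 + …))` of the bound polynomial `Z(r) = Σ_k Z_k r^k`
from its coefficient list `[Z_0, Z_1, …]` (`radii.py` `p_eval`). [folklore] -/
def evalCoeffs : List K → K → K
  | [], _ => 0
  | a :: l, r => a + r * evalCoeffs l r

/-- The general-degree radii polynomial `p(r) = Y₀ + (Z(r) − 1) r` with `Z(r) = Σ_k Z_k r^k`
(`radii.py` form `polynomial`; [DayLessardMischaikow2007] §2 radii polynomials of general degree, as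
cited by `radii.py` THEOREMS — printed pages not held).
[cite: DayLessardMischaikow2007, §2 (general-degree radii polynomial; as cited by cap.nk radii.py THEOREMS)] -/
def degPoly (Y₀ : K) (Zs : List K) (r : K) : K := Y₀ + (evalCoeffs Zs r - 1) * r

/-- `evalCoeffs` on the empty list. [folklore] -/
@[simp] private theorem evalCoeffs_nil (r : K) : evalCoeffs ([] : List K) r = 0 := rfl

/-- `evalCoeffs` on a cons. [folklore] -/
@[simp] private theorem evalCoeffs_cons (a : K) (l : List K) (r : K) :
    evalCoeffs (a :: l) r = a + r * evalCoeffs l r := rfl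

end Polynomials

section EndpointRule

variable {K : Type*} [Field K] [LinearOrder K] [IsStrictOrderedRing K]

/-- **Endpoint rule, contraction form**: `p(r) = (Z − 1) r + Y` is non-decreasing in `Y` and in `Z`
for `r ≥ 0` (so replacing true values by certified UPPER bounds is sound and tightest).
(The ENDPOINT RULE of cap.nk `radii.py`.)
[cite: ConstantineauGarciaAzpeitiaLessard2021, Thm. 3.1 (p(r) = (Z − 1) r + Y is non-decreasing in Y and Z)] -/
theorem contractionPoly_mono {Y Y' Z Z' r : K} (hr : 0 ≤ r) (hY : Y ≤ Y') (hZ : Z ≤ Z') :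
    contractionPoly Y Z r ≤ contractionPoly Y' Z' r := by
  unfold contractionPoly
  have : (Z - 1) * r ≤ (Z' - 1) * r := mul_le_mul_of_nonneg_right (by linarith) hr
  linarith

/-- **Endpoint rule, quadratic form**: `p(r) = Z₂ r² − (1 − Z₁ − Z₀) r + Y₀` is non-decreasing in each
of `Y₀, Z₀, Z₁, Z₂` for `r ≥ 0` (the ENDPOINT RULE of cap.nk `radii.py`).
[cite: LessardMirelesJames2017, Thm. 1.5 eq. (7) (p is non-decreasing in Y₀, Z₀, Z₁, Z₂)] -/
theorem quadraticPoly_mono {Y₀ Y₀' Z₀ Z₀' Z₁ Z₁' Z₂ Z₂' r : K} (hr : 0 ≤ r) (hY : Y₀ ≤ Y₀')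
    (h₀ : Z₀ ≤ Z₀') (h₁ : Z₁ ≤ Z₁') (h₂ : Z₂ ≤ Z₂') :
    quadraticPoly Y₀ Z₀ Z₁ Z₂ r ≤ quadraticPoly Y₀' Z₀' Z₁' Z₂' r := by
  unfold quadraticPoly
  have hsq : Z₂ * r ^ 2 ≤ Z₂' * r ^ 2 := mul_le_mul_of_nonneg_right h₂ (sq_nonneg r)
  have hlin : (Z₁ + Z₀ - 1) * r ≤ (Z₁' + Z₀' - 1) * r := mul_le_mul_of_nonneg_right (by linarith) hr
  nlinarith

/-- **Endpoint rule for `Z(r)`**: Horner evaluation at `r ≥ 0` is non-decreasing in every coefficient.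
[folklore] -/
private theorem evalCoeffs_mono {r : K} (hr : 0 ≤ r) {Zs Zs' : List K}
    (h : List.Forall₂ (· ≤ ·) Zs Zs') : evalCoeffs Zs r ≤ evalCoeffs Zs' r := by
  induction h with
  | nil => exact le_rfl
  | cons hab _ ih =>
    simp only [evalCoeffs_cons]
    exact add_le_add hab (mul_le_mul_of_nonneg_left ih hr)

/-- **Endpoint rule, general-degree form**: `p(r) = Y₀ + (Z(r) − 1) r` is non-decreasing in `Y₀` and in
every coefficient `Z_k` for `r ≥ 0` (the ENDPOINT RULE of cap.nk `radii.py`).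
[cite: DayLessardMischaikow2007, §2 (p(r) = Y₀ + (Z(r) − 1) r is non-decreasing in Y₀ and the Z_k; as cited by cap.nk radii.py)] -/
theorem degPoly_mono {Y₀ Y₀' r : K} {Zs Zs' : List K} (hr : 0 ≤ r) (hY : Y₀ ≤ Y₀')
    (hZ : List.Forall₂ (· ≤ ·) Zs Zs') : degPoly Y₀ Zs r ≤ degPoly Y₀' Zs' r := by
  unfold degPoly
  have : (evalCoeffs Zs r - 1) * r ≤ (evalCoeffs Zs' r - 1) * r :=
    mul_le_mul_of_nonneg_right (by linarith [evalCoeffs_mono hr hZ]) hr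
  linarith

/-- `p(r) < 0` at some `r > 0` with `Y₀ ≥ 0` forces the contraction constant `Z₀ + Z₁ + Z₂ r < 1`
(so `radii.py`'s line `Z01_lt_1` follows from `p_rmin_neg`; eq. (58)–(59) of [LessardMirelesJames2017]
App. A). [cite: LessardMirelesJames2017, App. A eqs. (58)–(59) (p. 37)] -/
theorem quadraticPoly_sum_lt_one {Y₀ Z₀ Z₁ Z₂ r : K} (hY : 0 ≤ Y₀) (hr : 0 < r)
    (hp : quadraticPoly Y₀ Z₀ Z₁ Z₂ r < 0) : Z₀ + Z₁ + Z₂ * r < 1 := by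
  unfold quadraticPoly at hp
  rw [← not_le]
  intro h
  nlinarith [mul_nonneg (sub_nonneg.2 h) hr.le]

/-- `p(r) = Y₀ + (Z(r) − 1) r < 0` at some `r > 0` with `Y₀ ≥ 0` forces `Z(r) < 1` (`radii.py` THEOREMS,
form `polynomial`: "then `Z(r₀) < 1`").
[cite: ConstantineauGarciaAzpeitiaLessard2021, Thm. 3.1 proof ("Z < 1"), with Z := Z(r₀)] -/
theorem evalCoeffs_lt_one_of_degPoly_neg {Y₀ r : K} {Zs : List K} (hY : 0 ≤ Y₀) (hr : 0 < r)
    (hp : degPoly Y₀ Zs r < 0) : evalCoeffs Zs r < 1 := by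
  unfold degPoly at hp
  rw [← not_le]
  intro h
  nlinarith [mul_nonneg (sub_nonneg.2 h) hr.le]

end EndpointRule

/-! ### Casting the exact-rational polynomials to `ℝ` -/

/-- `contractionPoly` commutes with `ℚ → ℝ`. [folklore] -/
private theorem cast_contractionPoly (Y Z r : ℚ) :
    ((contractionPoly Y Z r : ℚ) : ℝ) = contractionPoly (Y : ℝ) (Z : ℝ) (r : ℝ) := by
  simp only [contractionPoly, Rat.cast_add, Rat.cast_mul, Rat.cast_sub, Rat.cast_one]

/-- `quadraticPoly` commutes with `ℚ → ℝ`. [folklore] -/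
private theorem cast_quadraticPoly (Y₀ Z₀ Z₁ Z₂ r : ℚ) :
    ((quadraticPoly Y₀ Z₀ Z₁ Z₂ r : ℚ) : ℝ) =
      quadraticPoly (Y₀ : ℝ) (Z₀ : ℝ) (Z₁ : ℝ) (Z₂ : ℝ) (r : ℝ) := by
  simp only [quadraticPoly, Rat.cast_add, Rat.cast_mul, Rat.cast_sub, Rat.cast_one, Rat.cast_pow]

/-- `evalCoeffs` commutes with `ℚ → ℝ` (coefficient list mapped). [folklore] -/
private theorem cast_evalCoeffs (Zs : List ℚ) (r : ℚ) :
    ((evalCoeffs Zs r : ℚ) : ℝ) = evalCoeffs (Zs.map ((↑) : ℚ → ℝ)) (r : ℝ) := by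
  induction Zs with
  | nil => simp
  | cons a l ih => simp [ih]

/-- `degPoly` commutes with `ℚ → ℝ`. [folklore] -/
private theorem cast_degPoly (Y₀ : ℚ) (Zs : List ℚ) (r : ℚ) :
    ((degPoly Y₀ Zs r : ℚ) : ℝ) = degPoly (Y₀ : ℝ) (Zs.map ((↑) : ℚ → ℝ)) (r : ℝ) := by
  simp only [degPoly, Rat.cast_add, Rat.cast_mul, Rat.cast_sub, Rat.cast_one, cast_evalCoeffs]

/-! ## Form `contraction` (one bound `Z` on the ball `B̄(x̄, r*)`) -/

/-- **Closing certificate, form `contraction`** (cap-nk/1): exact rationals `Y ≥ ‖A F(x̄)‖`,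
`Z ≥ sup_{z ∈ B̄(x̄, r*)} ‖I − A DF(z)‖` (upper endpoints of the client's enclosures), the existence
radius `r_min` and the radius `r*` (lower endpoint) on which the client's `Z` bound holds, which is
also the uniqueness radius `r_max = r*`.
(Fields = the exact rationals of a cap-nk/1 document of form `contraction`.)
[cite: ConstantineauGarciaAzpeitiaLessard2021, Thm. 3.1 (arXiv p. 8), data of the closing] -/
structure ContractionCert where
  /-- `Y ≥ ‖A F(x̄)‖` (exact rational; `inputs.Y.exact`). -/
  Y : ℚ
  /-- `Z ≥ sup_{z ∈ B̄(x̄, r*)} ‖I − A DF(z)‖` (`inputs.Z.exact`). -/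
  Z : ℚ
  /-- The existence radius `r_min` (`result.r_min.exact`; `radii.py` takes `Y/(1 − Z)`). -/
  rmin : ℚ
  /-- The radius `r*` of the ball on which `Z` is a bound (`inputs.rstar.exact`, lower endpoint);
  `= r_max`, the uniqueness radius. -/
  rstar : ℚ

namespace ContractionCert

variable (c : ContractionCert)

/-- **The checker** (lines `Z_lt_1`, `radii_at_rmin`, `rmin_le_rstar` of `radii.py`, plus `0 ≤ r_min`):
`0 ≤ r_min ≤ r*`, `Z < 1`, `Y + Z·r_min ≤ r_min`.
[cite: ConstantineauGarciaAzpeitiaLessard2021, Thm. 3.1 (non-strict closing; = cap.nk radii.py `contraction` required lines)] -/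
def check : Bool :=
  decide (0 ≤ c.rmin) && decide (c.rmin ≤ c.rstar) && decide (c.Z < 1) &&
    decide (c.Y + c.Z * c.rmin ≤ c.rmin)

/-- `check` unfolded to its four inequalities (the transcript lines of cap.nk `radii.py`, form `contraction`).
[cite: ConstantineauGarciaAzpeitiaLessard2021, Thm. 3.1 (closing inequalities, unfolded)] -/
theorem check_eq_true_iff :
    c.check = true ↔ 0 ≤ c.rmin ∧ c.rmin ≤ c.rstar ∧ c.Z < 1 ∧ c.Y + c.Z * c.rmin ≤ c.rmin := by
  simp only [check, Bool.and_eq_true, decide_eq_true_eq, and_assoc]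

/-- **A cap-nk/1 PASS implies `check`**: from the strict line `radii_at_rmax: (Z − 1)·r* + Y < 0` and
`Z < 1`, `Y ≥ 0`, the certificate with `radii.py`'s canonical `r_min = Y/(1 − Z)` passes (its line
`radii_at_rmin` holds with equality). [cite: ConstantineauGarciaAzpeitiaLessard2021, Thm. 3.1 (p(r*) < 0 ⇒ closing at r_min = Y/(1 − Z))] -/
theorem check_of_strictLine {Y Z rstar : ℚ} (hY : 0 ≤ Y) (hZ : Z < 1)
    (hp : contractionPoly Y Z rstar < 0) :
    (⟨Y, Z, Y / (1 - Z), rstar⟩ : ContractionCert).check = true := by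
  rw [check_eq_true_iff]
  dsimp only
  unfold contractionPoly at hp
  have h1 : 0 < 1 - Z := by linarith
  have h1' : (1 - Z) ≠ 0 := h1.ne'
  refine ⟨div_nonneg hY h1.le, ?_, hZ, ?_⟩
  · rw [div_le_iff₀ h1]
    nlinarith
  · rw [show Y + Z * (Y / (1 - Z)) = Y / (1 - Z) by field_simp; ring]

/-- **Endpoint rule**: a passing certificate still passes with smaller bounds `Y' ≤ Y`, `Z' ≤ Z` and the
same radii (cap.nk `radii.py`: "the UPPER endpoint is used for Y, Z…").
[cite: ConstantineauGarciaAzpeitiaLessard2021, Thm. 3.1 (closing is monotone in the bounds Y, Z)] -/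
theorem check_mono {c c' : ContractionCert} (h : c.check = true) (hY : c'.Y ≤ c.Y) (hZ : c'.Z ≤ c.Z)
    (hmin : c'.rmin = c.rmin) (hstar : c'.rstar = c.rstar) : c'.check = true := by
  rw [check_eq_true_iff] at h ⊢
  obtain ⟨h0, h1, h2, h3⟩ := h
  refine ⟨by rw [hmin]; exact h0, by rw [hmin, hstar]; exact h1, lt_of_le_of_lt hZ h2, ?_⟩
  rw [hmin]
  have : c'.Z * c.rmin ≤ c.Z * c.rmin := mul_le_mul_of_nonneg_right hZ h0
  linarith

/-- **Soundness, form `contraction`.**  If the certificate passes and, for the client's data — `X` real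
Banach, `Y` real normed, `A : Y →L X` injective, `F` with Fréchet derivative `F'(x)` at every point of
`B̄(x̄, r*)`, `‖A F(x̄)‖ ≤ Y`, `‖I − A∘F'(z)‖ ≤ Z` on `B̄(x̄, r*)` (hypotheses (D), (Y), (Z), (A) of the
cap-nk/1 `hypotheses` block) — then `F` has a zero `x̃` with `‖x̃ − x̄‖ ≤ r_min`, it is the only zero of
`F` in `B̄(x̄, r*)`, every `F'(z)`, `z ∈ B̄(x̄, r*)`, is invertible with `‖F'(z)⁻¹‖ ≤ ‖A‖/(1 − Z)`, and the
Newton-like iterates `x_{n+1} = x_n − A F(x_n)` from `x̄` converge to `x̃`.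
(Non-degeneracy: Argyros 2008 Thm. 1.1.12 (1.1.10); sentence = cap.nk `radii.py` `contraction` result.)
[cite: ConstantineauGarciaAzpeitiaLessard2021, Thm. 3.1 (arXiv p. 8), certificate form] -/
theorem sound {X Y : Type*} [NormedAddCommGroup X] [NormedSpace ℝ X] [CompleteSpace X]
    [NormedAddCommGroup Y] [NormedSpace ℝ Y] (hc : c.check = true)
    {F : X → Y} {F' : X → X →L[ℝ] Y} {xbar : X} {A : Y →L[ℝ] X} (hA : Injective A)
    (hF : ∀ x ∈ closedBall xbar (c.rstar : ℝ), HasFDerivAt F (F' x) x)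
    (hY : ‖A (F xbar)‖ ≤ (c.Y : ℝ))
    (hZ : ∀ x ∈ closedBall xbar (c.rstar : ℝ),
      ‖ContinuousLinearMap.id ℝ X - A.comp (F' x)‖ ≤ (c.Z : ℝ)) :
    ∃ x ∈ closedBall xbar (c.rmin : ℝ), F x = 0 ∧
      (∀ y ∈ closedBall xbar (c.rstar : ℝ), F y = 0 → y = x) ∧
      (∀ z ∈ closedBall xbar (c.rstar : ℝ), ∃ L : X ≃L[ℝ] Y, (L : X →L[ℝ] Y) = F' z ∧
        ‖(L.symm : Y →L[ℝ] X)‖ ≤ ‖A‖ / (1 - (c.Z : ℝ))) ∧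
      Tendsto (fun n => (newtonLikeMap A F)^[n] xbar) atTop (𝓝 x) := by
  obtain ⟨h0, h1, h2, h3⟩ := c.check_eq_true_iff.1 hc
  have h0' : (0 : ℝ) ≤ c.rmin := by exact_mod_cast h0
  have h1' : (c.rmin : ℝ) ≤ c.rstar := by exact_mod_cast h1
  have h2' : (c.Z : ℝ) < 1 := by exact_mod_cast h2
  have h3' : (c.Y : ℝ) + c.Z * c.rmin ≤ c.rmin := by exact_mod_cast h3
  obtain ⟨x, hx, hfx, huniq, htend⟩ :=
    existsUnique_zero_of_newtonLike_twoRadii_of_le h0' h1' hA hF hY hZ h2' h3'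
  exact ⟨x, hx, hfx, huniq, fun z hz => fderiv_invertible_of_newtonLike hA hZ h2' hz, htend⟩

/-- **Inverse factor** (`radii.py` `result.inverse_factor = 1/(1 − Z)`; Calleja et al. 2021 Cor. 9):
under `check` and hypothesis (Z), for every `z ∈ B̄(x̄, r*)` the operator `A ∘ F'(z)` is invertible in
`B(X)` with `‖(A∘F'(z))⁻¹‖ ≤ 1/(1 − Z)` (Neumann series).
(Neumann bound: Kress 1999 Thm. 2.14.) [cite: CallejaEtAl2021, Cor. 9 (‖(A DF)⁻¹‖ ≤ 1/(1 − Z))] -/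
theorem inverseFactor {X Y : Type*} [NormedAddCommGroup X] [NormedSpace ℝ X] [CompleteSpace X]
    [NormedAddCommGroup Y] [NormedSpace ℝ Y] (hc : c.check = true)
    {F' : X → X →L[ℝ] Y} {xbar : X} {A : Y →L[ℝ] X}
    (hZ : ∀ x ∈ closedBall xbar (c.rstar : ℝ),
      ‖ContinuousLinearMap.id ℝ X - A.comp (F' x)‖ ≤ (c.Z : ℝ))
    {z : X} (hz : z ∈ closedBall xbar (c.rstar : ℝ)) :
    ∃ e : X ≃L[ℝ] X, (e : X →L[ℝ] X) = A.comp (F' z) ∧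
      ‖(e.symm : X →L[ℝ] X)‖ ≤ 1 / (1 - (c.Z : ℝ)) := by
  obtain ⟨-, -, h2, -⟩ := c.check_eq_true_iff.1 hc
  have h2' : (c.Z : ℝ) < 1 := by exact_mod_cast h2
  obtain ⟨e, he⟩ := isInvertible_comp_of_norm_id_sub_lt (A := A) (B := F' z)
    (lt_of_le_of_lt (hZ z hz) h2')
  exact ⟨e, he, norm_symm_le_of_norm_id_sub_le e (by rw [he]; exact hZ z hz) h2'⟩

end ContractionCert

/-! ## Form `quadratic` (bounds `Y₀, Z₀, Z₁, Z₂`; two radii `r_min ≤ r_max ≤ r*`) -/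

/-- **Closing certificate, form `quadratic`** (cap-nk/1): exact rationals `Y₀, Z₀, Z₁, Z₂` (upper
endpoints of the bounds (3)–(6) of [LessardMirelesJames2017] Thm. 1.5, with (6) required for every
radius `0 < r ≤ r*`), the two radii `r_min ≤ r_max` at which `radii.py` verified `p < 0`, and `r*`.
(Fields = the exact rationals of a cap-nk/1 document of form `quadratic`.)
[cite: LessardMirelesJames2017, Thm. 1.5 (pp. 4–5), data of the closing] -/
structure QuadraticCert where
  /-- `Y₀ ≥ ‖A F(x̄)‖` (bound (3)). -/
  Y₀ : ℚ
  /-- `Z₀ ≥ ‖I − A A†‖` (bound (4)). -/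
  Z₀ : ℚ
  /-- `Z₁ ≥ ‖A (DF(x̄) − A†)‖` (bound (5)). -/
  Z₁ : ℚ
  /-- `Z₂` with `‖A (DF(b) − DF(x̄))‖ ≤ Z₂ r` for all `b ∈ B̄_r(x̄)`, `0 < r ≤ r*` (bound (6)). -/
  Z₂ : ℚ
  /-- The existence radius `r_min` (`result.r_min.exact`). -/
  rmin : ℚ
  /-- The uniqueness radius `r_max` (`result.r_max.exact`). -/
  rmax : ℚ
  /-- The radius `r*` up to which the client's `Z₂` bound holds (`inputs.rstar.exact`, lower endpoint;
  a client with a global `Z₂` puts `r* := r_max`). -/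
  rstar : ℚ

namespace QuadraticCert

variable (c : QuadraticCert)

/-- The certificate's radii polynomial `p(r) = Z₂ r² − (1 − Z₁ − Z₀) r + Y₀` over `ℚ`.
[cite: LessardMirelesJames2017, Thm. 1.5 eq. (7)] -/
def p (r : ℚ) : ℚ := quadraticPoly c.Y₀ c.Z₀ c.Z₁ c.Z₂ r

/-- **The checker** (lines `p_rmin_neg`, `p_rmax_neg`, `rmin_le_rmax`, `rmax_le_rstar` of `radii.py`, plus
`0 < r_min`): `0 < r_min ≤ r_max ≤ r*`, `p(r_min) < 0`, `p(r_max) < 0`.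
[cite: LessardMirelesJames2017, Thm. 1.5 (closing p(r) < 0 at two radii; = cap.nk radii.py `quadratic` required lines)] -/
def check : Bool :=
  decide (0 < c.rmin) && decide (c.rmin ≤ c.rmax) && decide (c.rmax ≤ c.rstar) &&
    decide (c.p c.rmin < 0) && decide (c.p c.rmax < 0)

/-- `check` unfolded to its five inequalities (the transcript lines of cap.nk `radii.py`, form `quadratic`).
[cite: LessardMirelesJames2017, Thm. 1.5 (closing inequalities p(r) < 0, unfolded)] -/
theorem check_eq_true_iff :
    c.check = true ↔
      0 < c.rmin ∧ c.rmin ≤ c.rmax ∧ c.rmax ≤ c.rstar ∧ c.p c.rmin < 0 ∧ c.p c.rmax < 0 := by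
  simp only [check, Bool.and_eq_true, decide_eq_true_eq, and_assoc]

/-- **Endpoint rule**: a passing certificate still passes with smaller bounds `Y₀' ≤ Y₀`, `Z₀' ≤ Z₀`,
`Z₁' ≤ Z₁`, `Z₂' ≤ Z₂` and the same radii (cap.nk `radii.py`: "every radii polynomial is non-decreasing in the
bounds"). [cite: LessardMirelesJames2017, Thm. 1.5 eq. (7) (closing is monotone in the bounds Y₀, Z₀, Z₁, Z₂)] -/
theorem check_mono {c c' : QuadraticCert} (h : c.check = true) (hY : c'.Y₀ ≤ c.Y₀) (h₀ : c'.Z₀ ≤ c.Z₀)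
    (h₁ : c'.Z₁ ≤ c.Z₁) (h₂ : c'.Z₂ ≤ c.Z₂) (hmin : c'.rmin = c.rmin) (hmax : c'.rmax = c.rmax)
    (hstar : c'.rstar = c.rstar) : c'.check = true := by
  rw [check_eq_true_iff] at h ⊢
  obtain ⟨h0, h1, h2, h3, h4⟩ := h
  refine ⟨by rw [hmin]; exact h0, by rw [hmin, hmax]; exact h1, by rw [hmax, hstar]; exact h2, ?_, ?_⟩
  · rw [p, hmin]
    exact lt_of_le_of_lt (quadraticPoly_mono h0.le hY h₀ h₁ h₂) h3
  · rw [p, hmax]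
    exact lt_of_le_of_lt (quadraticPoly_mono (h0.le.trans h1) hY h₀ h₁ h₂) h4

/-- **Soundness, form `quadratic`** ([LessardMirelesJames2017] Thm. 1.5 in two-radii form).  If the
certificate passes and, for the client's data — `X` real Banach, `Y` real normed, `A† : X →L Y`,
`A : Y →L X` injective, `F` with Fréchet derivative `F'(x)` at every point of `B̄(x̄, r*)`, and the bounds
(3) `‖A F(x̄)‖ ≤ Y₀`, (4) `‖I − A A†‖ ≤ Z₀`, (5) `‖A(F'(x̄) − A†)‖ ≤ Z₁`, (6) `‖A(F'(b) − F'(x̄))‖ ≤ Z₂ r`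
for all `b ∈ B̄_r(x̄)` and all `0 < r ≤ r*` — then `F` has a zero `x̃` in the OPEN ball `B(x̄, r_min)`, it
is the only zero of `F` in `B̄(x̄, r_max)`, every `F'(z)`, `z ∈ B̄(x̄, r_max)`, is invertible with
`‖F'(z)⁻¹‖ ≤ ‖A‖/(1 − (Z₀ + Z₁ + Z₂ r_max))`, and the Newton-like iterates from `x̄` converge to `x̃`.
(Sentence = cap.nk `radii.py` `quadratic` result, two radii.)
[cite: LessardMirelesJames2017, Thm. 1.5 (pp. 4–5; proof App. A pp. 36–37), certificate form] -/
theorem sound {X Y : Type*} [NormedAddCommGroup X] [NormedSpace ℝ X] [CompleteSpace X]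
    [NormedAddCommGroup Y] [NormedSpace ℝ Y] (hc : c.check = true)
    {F : X → Y} {F' : X → X →L[ℝ] Y} {xbar : X} {A : Y →L[ℝ] X} {Adag : X →L[ℝ] Y}
    (hA : Injective A)
    (hF : ∀ x ∈ closedBall xbar (c.rstar : ℝ), HasFDerivAt F (F' x) x)
    (hY : ‖A (F xbar)‖ ≤ (c.Y₀ : ℝ))
    (hZ₀ : ‖ContinuousLinearMap.id ℝ X - A.comp Adag‖ ≤ (c.Z₀ : ℝ))
    (hZ₁ : ‖A.comp (F' xbar - Adag)‖ ≤ (c.Z₁ : ℝ))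
    (hZ₂ : ∀ r : ℝ, 0 < r → r ≤ (c.rstar : ℝ) → ∀ b ∈ closedBall xbar r,
      ‖A.comp (F' b - F' xbar)‖ ≤ (c.Z₂ : ℝ) * r) :
    ∃ x ∈ ball xbar (c.rmin : ℝ), F x = 0 ∧
      (∀ y ∈ closedBall xbar (c.rmax : ℝ), F y = 0 → y = x) ∧
      (∀ z ∈ closedBall xbar (c.rmax : ℝ), ∃ L : X ≃L[ℝ] Y, (L : X →L[ℝ] Y) = F' z ∧
        ‖(L.symm : Y →L[ℝ] X)‖ ≤ ‖A‖ / (1 - ((c.Z₀ : ℝ) + c.Z₁ + c.Z₂ * c.rmax))) ∧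
      Tendsto (fun n => (newtonLikeMap A F)^[n] xbar) atTop (𝓝 x) := by
  obtain ⟨h0, h1, h2, h3, h4⟩ := c.check_eq_true_iff.1 hc
  have h0' : (0 : ℝ) < c.rmin := by exact_mod_cast h0
  have h1' : (c.rmin : ℝ) ≤ c.rmax := by exact_mod_cast h1
  have h2' : (c.rmax : ℝ) ≤ c.rstar := by exact_mod_cast h2
  have h3' : (c.Z₂ : ℝ) * (c.rmin : ℝ) ^ 2 - (1 - c.Z₁ - c.Z₀) * c.rmin + c.Y₀ < 0 := by
    have := (Rat.cast_lt (K := ℝ)).2 h3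
    rw [p, cast_quadraticPoly, Rat.cast_zero] at this
    simpa only [quadraticPoly] using this
  have h4' : (c.Z₂ : ℝ) * (c.rmax : ℝ) ^ 2 - (1 - c.Z₁ - c.Z₀) * c.rmax + c.Y₀ < 0 := by
    have := (Rat.cast_lt (K := ℝ)).2 h4
    rw [p, cast_quadraticPoly, Rat.cast_zero] at this
    simpa only [quadraticPoly] using this
  have hF' : ∀ x ∈ closedBall xbar (c.rmax : ℝ), HasFDerivAt F (F' x) x :=
    fun x hx => hF x (closedBall_subset_closedBall h2' hx)
  have hZ₂' : ∀ r : ℝ, 0 < r → r ≤ (c.rmax : ℝ) → ∀ b ∈ closedBall xbar r,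
      ‖A.comp (F' b - F' xbar)‖ ≤ (c.Z₂ : ℝ) * r :=
    fun r hr hrr b hb => hZ₂ r hr (hrr.trans h2') b hb
  exact existsUnique_zero_of_radiiPolynomial_twoRadii h0' h1' hA hF' hY hZ₀ hZ₁ hZ₂' h3' h4'

end QuadraticCert

/-! ## Form `polynomial` (general-degree bound `Z(r) = Σ_k Z_k r^k` on `B̄(x̄, r)`, `0 ≤ r ≤ r*`) -/

/-- **Closing certificate, form `polynomial`** (cap-nk/1): exact rationals `Y₀ ≥ ‖A F(x̄)‖` and the
coefficients `[Z_0, Z_1, …]` of a polynomial `Z(r)` with `Z(r) ≥ sup_{b ∈ B̄(x̄, r)} ‖I − A DF(b)‖` for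
`0 ≤ r ≤ r*` (upper endpoints), the two radii `r_min ≤ r_max` at which `radii.py` verified
`p(r) = Y₀ + (Z(r) − 1) r < 0`, and `r*`.
(Fields = the exact rationals of a cap-nk/1 document of form `polynomial`; theorem = Constantineau–García-Azpeitia–Lessard
2021 Thm. 3.1 at `r* = r₀`.) [cite: DayLessardMischaikow2007, §2 (general-degree radii polynomial; as cited by cap.nk radii.py THEOREMS), data of the closing] -/
structure PolynomialCert where
  /-- `Y₀ ≥ ‖A F(x̄)‖`. -/
  Y₀ : ℚ
  /-- The coefficients `[Z_0, Z_1, …]` of `Z(r) = Σ_k Z_k r^k`. -/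
  Zs : List ℚ
  /-- The existence radius `r_min`. -/
  rmin : ℚ
  /-- The uniqueness radius `r_max`. -/
  rmax : ℚ
  /-- The radius `r*` up to which `Z(r)` bounds the sup (`inputs.rstar.exact`, lower endpoint; a client
  with a global bound puts `r* := r_max`). -/
  rstar : ℚ

namespace PolynomialCert

variable (c : PolynomialCert)

/-- The certificate's bound polynomial `Z(r)` over `ℚ` (Horner). [folklore] -/
def Z (r : ℚ) : ℚ := evalCoeffs c.Zs r

/-- The certificate's radii polynomial `p(r) = Y₀ + (Z(r) − 1) r` over `ℚ`.
[cite: DayLessardMischaikow2007, §2 (as cited by cap.nk radii.py `p_eval`)] -/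
def p (r : ℚ) : ℚ := degPoly c.Y₀ c.Zs r

/-- **The checker** (lines `p_rmin_neg`, `p_rmax_neg`, `rmin_le_rmax`, `rmax_le_rstar` of `radii.py`, plus
`0 < r_min`): `0 < r_min ≤ r_max ≤ r*`, `p(r_min) < 0`, `p(r_max) < 0` (= cap.nk `radii.py` `polynomial` required lines).
[cite: ConstantineauGarciaAzpeitiaLessard2021, Thm. 3.1 (closing p(r₀) < 0, at two radii)] -/
def check : Bool :=
  decide (0 < c.rmin) && decide (c.rmin ≤ c.rmax) && decide (c.rmax ≤ c.rstar) &&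
    decide (c.p c.rmin < 0) && decide (c.p c.rmax < 0)

/-- `check` unfolded to its five inequalities (the transcript lines of cap.nk `radii.py`, form `polynomial`).
[cite: ConstantineauGarciaAzpeitiaLessard2021, Thm. 3.1 (closing inequalities p(r₀) < 0 at two radii, unfolded)] -/
theorem check_eq_true_iff :
    c.check = true ↔
      0 < c.rmin ∧ c.rmin ≤ c.rmax ∧ c.rmax ≤ c.rstar ∧ c.p c.rmin < 0 ∧ c.p c.rmax < 0 := by
  simp only [check, Bool.and_eq_true, decide_eq_true_eq, and_assoc]

/-- **Endpoint rule**: a passing certificate still passes with a smaller `Y₀' ≤ Y₀`, coefficientwise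
smaller `Z'_k ≤ Z_k`, and the same radii (ENDPOINT RULE of cap.nk `radii.py`).
[cite: DayLessardMischaikow2007, §2 (closing is monotone in Y₀ and the Z_k; as cited by cap.nk radii.py)] -/
theorem check_mono {c c' : PolynomialCert} (h : c.check = true) (hY : c'.Y₀ ≤ c.Y₀)
    (hZ : List.Forall₂ (· ≤ ·) c'.Zs c.Zs) (hmin : c'.rmin = c.rmin) (hmax : c'.rmax = c.rmax)
    (hstar : c'.rstar = c.rstar) : c'.check = true := by
  rw [check_eq_true_iff] at h ⊢
  obtain ⟨h0, h1, h2, h3, h4⟩ := h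
  refine ⟨by rw [hmin]; exact h0, by rw [hmin, hmax]; exact h1, by rw [hmax, hstar]; exact h2, ?_, ?_⟩
  · rw [p, hmin]
    exact lt_of_le_of_lt (degPoly_mono h0.le hY hZ) h3
  · rw [p, hmax]
    exact lt_of_le_of_lt (degPoly_mono (h0.le.trans h1) hY hZ) h4

/-- **Soundness, form `polynomial`** (contraction form [ConstantineauGarciaAzpeitiaLessard2021] Thm. 3.1
applied at `r* = r₀ = r_min` and at `r* = r₀ = r_max` with `Z := Z(r_min)`, `Z(r_max)`).  If the
certificate passes and, for the client's data — `X` real Banach, `Y` real normed, `A : Y →L X` injective,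
`F` with Fréchet derivative `F'(x)` at every point of `B̄(x̄, r*)`, `‖A F(x̄)‖ ≤ Y₀`, and
`‖I − A∘F'(b)‖ ≤ Z(r)` for all `b ∈ B̄(x̄, r)` and all `0 ≤ r ≤ r*` (with `Z(r)` the real evaluation of
the certificate's coefficient list) — then `F` has a zero `x̃` in the OPEN ball `B(x̄, r_min)`, it is the
only zero of `F` in `B̄(x̄, r_max)`, every `F'(z)`, `z ∈ B̄(x̄, r_max)`, is invertible with
`‖F'(z)⁻¹‖ ≤ ‖A‖/(1 − Z(r_max))`, and the Newton-like iterates from `x̄` converge to `x̃`.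
(Sentence = cap.nk `radii.py` `polynomial` result; Day–Lessard–Mischaikow 2007 §2.)
[cite: ConstantineauGarciaAzpeitiaLessard2021, Thm. 3.1 (arXiv p. 8), applied at r* = r₀ ∈ {r_min, r_max}] -/
theorem sound {X Y : Type*} [NormedAddCommGroup X] [NormedSpace ℝ X] [CompleteSpace X]
    [NormedAddCommGroup Y] [NormedSpace ℝ Y] (hc : c.check = true)
    {F : X → Y} {F' : X → X →L[ℝ] Y} {xbar : X} {A : Y →L[ℝ] X} (hA : Injective A)
    (hF : ∀ x ∈ closedBall xbar (c.rstar : ℝ), HasFDerivAt F (F' x) x)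
    (hY : ‖A (F xbar)‖ ≤ (c.Y₀ : ℝ))
    (hZ : ∀ r : ℝ, 0 ≤ r → r ≤ (c.rstar : ℝ) → ∀ b ∈ closedBall xbar r,
      ‖ContinuousLinearMap.id ℝ X - A.comp (F' b)‖ ≤ evalCoeffs (c.Zs.map ((↑) : ℚ → ℝ)) r) :
    ∃ x ∈ ball xbar (c.rmin : ℝ), F x = 0 ∧
      (∀ y ∈ closedBall xbar (c.rmax : ℝ), F y = 0 → y = x) ∧
      (∀ z ∈ closedBall xbar (c.rmax : ℝ), ∃ L : X ≃L[ℝ] Y, (L : X →L[ℝ] Y) = F' z ∧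
        ‖(L.symm : Y →L[ℝ] X)‖ ≤ ‖A‖ / (1 - evalCoeffs (c.Zs.map ((↑) : ℚ → ℝ)) (c.rmax : ℝ))) ∧
      Tendsto (fun n => (newtonLikeMap A F)^[n] xbar) atTop (𝓝 x) := by
  obtain ⟨h0, h1, h2, h3, h4⟩ := c.check_eq_true_iff.1 hc
  have h0' : (0 : ℝ) < c.rmin := by exact_mod_cast h0
  have h1' : (c.rmin : ℝ) ≤ c.rmax := by exact_mod_cast h1
  have h2' : (c.rmax : ℝ) ≤ c.rstar := by exact_mod_cast h2
  have hmax0 : (0 : ℝ) < c.rmax := lt_of_lt_of_le h0' h1'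
  have hY₀ : (0 : ℝ) ≤ c.Y₀ := le_trans (norm_nonneg _) hY
  -- the two closing inequalities, cast to `ℝ`, in the CGL form `(Z − 1) r + Y₀ < 0`
  have h3' : (evalCoeffs (c.Zs.map ((↑) : ℚ → ℝ)) (c.rmin : ℝ) - 1) * c.rmin + c.Y₀ < 0 := by
    have := (Rat.cast_lt (K := ℝ)).2 h3
    rw [p, cast_degPoly, Rat.cast_zero, degPoly] at this
    linarith
  have h4' : (evalCoeffs (c.Zs.map ((↑) : ℚ → ℝ)) (c.rmax : ℝ) - 1) * c.rmax + c.Y₀ < 0 := by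
    have := (Rat.cast_lt (K := ℝ)).2 h4
    rw [p, cast_degPoly, Rat.cast_zero, degPoly] at this
    linarith
  -- sup bounds on the two balls
  have hZ₁ : ∀ x ∈ closedBall xbar (c.rmin : ℝ), ‖ContinuousLinearMap.id ℝ X - A.comp (F' x)‖ ≤
      evalCoeffs (c.Zs.map ((↑) : ℚ → ℝ)) (c.rmin : ℝ) :=
    fun x hx => hZ _ h0'.le (h1'.trans h2') x hx
  have hZ₂ : ∀ x ∈ closedBall xbar (c.rmax : ℝ), ‖ContinuousLinearMap.id ℝ X - A.comp (F' x)‖ ≤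
      evalCoeffs (c.Zs.map ((↑) : ℚ → ℝ)) (c.rmax : ℝ) :=
    fun x hx => hZ _ hmax0.le h2' x hx
  have hF₁ : ∀ x ∈ closedBall xbar (c.rmin : ℝ), HasFDerivAt F (F' x) x :=
    fun x hx => hF x (closedBall_subset_closedBall (h1'.trans h2') hx)
  have hF₂ : ∀ x ∈ closedBall xbar (c.rmax : ℝ), HasFDerivAt F (F' x) x :=
    fun x hx => hF x (closedBall_subset_closedBall h2' hx)
  -- existence in the open ball `B(x̄, r_min)`
  obtain ⟨x, hx, hfx, -, htend⟩ :=
    existsUnique_zero_of_newtonLike_twoRadii h0' le_rfl hA hF₁ hY hZ₁ h3'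
  -- uniqueness in `B̄(x̄, r_max)`
  obtain ⟨x', -, hfx', huniq', -⟩ :=
    existsUnique_zero_of_newtonLike_twoRadii hmax0 le_rfl hA hF₂ hY hZ₂ h4'
  have hxx' : x = x' :=
    huniq' x (closedBall_subset_closedBall h1' (ball_subset_closedBall hx)) hfx
  have hZlt : evalCoeffs (c.Zs.map ((↑) : ℚ → ℝ)) (c.rmax : ℝ) < 1 := by
    rw [← not_le]
    intro h
    nlinarith [mul_nonneg (sub_nonneg.2 h) hmax0.le]
  refine ⟨x, hx, hfx, fun y hy hfy => ?_,
    fun z hz => fderiv_invertible_of_newtonLike hA hZ₂ hZlt hz, htend⟩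
  rw [hxx']
  exact huniq' y hy hfy

end PolynomialCert

/-! ## Replay on sample numbers (the shape of a client row: `rw [check_eq_true_iff]; norm_num`, or `decide +kernel`) -/

/-- A `contraction` certificate with `Y = 1/10`, `Z = 1/2`, `r_min = Y/(1 − Z) = 1/5`, `r* = 1`
passes (line `radii_at_rmin` with equality), decided by the kernel. [folklore] -/
private theorem contraction_example : (⟨1/10, 1/2, 1/5, 1⟩ : ContractionCert).check = true := by
  decide +kernel

/-- A `quadratic` certificate with `Y₀ = 1/100`, `Z₀ = 1/10`, `Z₁ = 1/10`, `Z₂ = 1`,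
`r_min = 1/50`, `r_max = 1/2`, `r* = 1/2` passes (`p(1/50) = −7/1250`, `p(1/2) = −7/50`).
[folklore] -/
private theorem quadratic_example : (⟨1/100, 1/10, 1/10, 1, 1/50, 1/2, 1/2⟩ : QuadraticCert).check = true := by
  rw [QuadraticCert.check_eq_true_iff]
  norm_num [QuadraticCert.p, quadraticPoly]

/-- A `polynomial` certificate with `Y₀ = 1/100`, `Z(r) = 1/5 + r + r²`, `r_min = 1/50`,
`r_max = 1/2`, `r* = 1/2` passes (`p(1/50) = −699/125000`, `p(1/2) = −3/200`). [folklore] -/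
private theorem polynomial_example :
    (⟨1/100, [1/5, 1, 1], 1/50, 1/2, 1/2⟩ : PolynomialCert).check = true := by
  rw [PolynomialCert.check_eq_true_iff]
  norm_num [PolynomialCert.p, degPoly]

end RadiiPolynomialCertificate

end Literature.Computation.Certificates
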